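import Summits.BirchSwinnertonDyer.BirchSwinnertonDyer.Theorems.KolyvaginRoadThreeMethod2Defs
import Literature.NumberTheory.EllipticCurves.ModPIrreducibleCongruenceTransferProofs
import Literature.NumberTheory.EllipticCurves.HeegnerPointsKolyvaginLocalCriterion
import Literature.NumberTheory.EllipticCurves.HeegnerPointsKolyvaginConjugation
import Literature.NumberTheory.EllipticCurves.HeegnerPointsKolyvaginGoodReductionProofs
import Literature.NumberTheory.EllipticCurves.ZpExtensionProofs
import Literature.NumberTheory.EllipticCurves.KummerSelmerStructure
import Literature.NumberTheory.EllipticCurves.GoodReductionUnramifiedProofs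
import Literature.NumberTheory.GaloisRepresentations.AbsIntegersEquiv
import Literature.NumberTheory.GaloisRepresentations.FrobeniusPlaces
import Literature.NumberTheory.GaloisRepresentations.IntegralGaloisActionProofs
import HarnessLib

/-!
# Method 2 at `p = 3` — the Frobenius at a good unipotent-admissible prime is a non-trivial unipotent on `E[3]`

Sub-problem `BirchSwinnertonDyer`, route `KolyvaginRoadThree`, METHOD line (koly v2x) on the crux
`ZhangSharpFrameAtThreeHL` (`stmt-BirchSwinnertonDyer-19574`).  This file is the local input of the
transversality (Trans) of koly3a's reduction of stub A (`selQ_rankLowering_on_of_localGlobal`, binder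
`htrans`): at a GOOD unipotent-admissible prime `q` (`IsUAdmissiblePrime W K q` with `FrobSqNeOneAt W 3 q`)
the Frobenius of the imaginary quadratic field `K` at its (inert) place `w ∣ q` acts on `E[3](K̄)` as a
NON-TRIVIAL UNIPOTENT: `(F − 1)² = 0 ≠ F − 1`, hence `ker (F − 1) = im (F − 1)` (a line).

* §A `frobSq_sub_one_sq_apply_eq_zero` — over `ℚ`: for an arithmetic Frobenius `h` at a prime of `\bar ℤ`
  above `q` (`q` prime, `q ≠ 3`, good reduction, `q ≡ 1 (mod 3)`, `3 ∤ a_q`), `(h² − 1)² = 0` on `E[3](ℚ̄)`.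
  Cayley–Hamilton on the `𝔽₃`-plane `E[3]` (`tr h = a_q`, `det h = q`, the tree's
  `trace_galoisRepTorsion_frobenius_eq` / `det_galoisRepTorsion_frobenius_eq`, Serre 1981 (238) / DDT 2.8):
  `h² = a h − 1` with `a = ±1`, so `h² − 1 = a h + 1` and `(a h + 1)² = 3 a h = 0`.
* §B `absGaloisRestrict_mul_inv_sq_mem_inertia` — residue arithmetic: a `K`-Frobenius `F` at `𝔓 ∣ w`
  (`x ↦ x^{q²}`, `#𝓞_K/w = q²` at an inert `q`) restricted to `\bar ℤ` differs from `h²` (`h` a `ℚ`-Frobenius at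
  the trace prime `𝔓' = 𝔓 ∩ \bar ℤ`, `x ↦ x^q`) by an element of the inertia group `I_{𝔓'}`.
* §B `exists_frobenius_unipotent` — the package at `K`: a `K`-Frobenius `F` at the prime `𝔓_{ι₀,𝔐} ∣ w` cut out
  by the chosen embedding `K̄ → K̄_w`, with `F (F Q − Q) = F Q − Q` for all `Q ∈ E[3](K̄)` and
  `ker (F − 1) ⊆ im (F − 1)`.  Transport of §A along `E[3](ℚ̄) ≃ E[3](K̄)` (`RatClosure.torsionEquiv`; inertia
  acts trivially at good `q ≠ 3`, `smul_geomTorsion_eq_of_mem_inertia`), non-triviality from `FrobSqNeOneAt`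
  (conjugating the given Frobenius to `𝔓'`), and counting in the group `E[3](K̄)` of order `9`.

References: Gross 1991 §4 (Frobenius at Kolyvagin primes on `E[p]`); Zhang 2014 §5 (level raising at
admissible primes); Serre 1981 §8.1; Silverman AEC VII.4.1.
-/

noncomputable section

open scoped Classical Pointwise
open Polynomial

namespace Summit.BirchSwinnertonDyer.Rank1Residual.X11b.Three.Koly.Method2.Iso

open WeierstrassCurve Field Function NumberField IsDedekindDomain Rat.HeightOneSpectrum
open Literature.NumberTheory.EllipticCurves Literature.NumberTheory.GaloisRepresentations Module

section FrobUnipotent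

variable {k : Type*} [Field k] {V : Type*} [AddCommGroup V] [Module k V] [FiniteDimensional k V]

/-- On a `2`-dimensional space the characteristic polynomial of an endomorphism `f` is
`X² − tr(f) X + det(f)` (Mathlib `Matrix.charpoly_fin_two` in a basis; a private copy of the tree's lemma in
`ModPCongruenceIsomorphismProofs`). [folklore] -/
private theorem charpoly_eq_of_finrank_eq_two (h2 : Module.finrank k V = 2) (f : Module.End k V) :
    f.charpoly = X ^ 2 - C (LinearMap.trace k V f) * X + C (LinearMap.det f) := by
  let b := Module.finBasisOfFinrankEq k V h2
  rw [← LinearMap.charpoly_toMatrix f b, Matrix.charpoly_fin_two,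
    ← LinearMap.trace_eq_matrix_trace k b f, LinearMap.det_toMatrix b f]

/-- Cayley–Hamilton in dimension `2`, pointwise: `f (f x) = tr(f) • f x - det(f) • x`. [folklore] -/
private theorem apply_apply_eq_of_finrank_eq_two (h2 : Module.finrank k V = 2) (f : Module.End k V) (x : V) :
    f (f x) = LinearMap.trace k V f • f x - LinearMap.det f • x := by
  have hCH := LinearMap.aeval_self_charpoly f
  rw [charpoly_eq_of_finrank_eq_two h2, map_add, map_sub, map_mul, aeval_C, aeval_C, map_pow, aeval_X] at hCH
  have h := congrArg (fun g : Module.End k V => g x) hCH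
  simp only [LinearMap.add_apply, LinearMap.sub_apply, LinearMap.zero_apply, Module.End.mul_apply,
    pow_two, Module.algebraMap_end_apply] at h
  -- h : f (f x) - tr • f x + det • x = 0
  rw [sub_add_eq_add_sub, sub_eq_zero] at h
  rw [eq_sub_iff_add_eq]
  rw [← h]

/-- In `ZMod 3` every non-zero element squares to `1`. [folklore] -/
private theorem zmod3_mul_self_eq_one : ∀ b : ZMod 3, b ≠ 0 → b * b = 1 := by decide

/-- `3 = 0` in `ZMod 3`. [folklore] -/
private theorem zmod3_three_eq_zero : (3 : ZMod 3) = 0 := by decide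

variable (W : WeierstrassCurve ℚ) [W.IsElliptic] [W.IsGloballyMinimal]

/-- **§A. `(Frob_q² − 1)² = 0` on `E[3](ℚ̄)` at a good unipotent-admissible prime.**  For `W/ℚ` in
global minimal form, a prime `q ≠ 3` of good reduction with `q ≡ 1 (mod 3)` and `3 ∤ a_q`, a place `v`
of `ℚ` at `q`, a prime `𝔓 ∣ v` of `\bar ℤ` and an arithmetic Frobenius `h` at `𝔓`:
`h² (h² P − P) − (h² P − P) = 0` for every `P ∈ E[3](ℚ̄)`.  Cayley–Hamilton on the `𝔽₃`-plane `E[3]`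
with `tr = a_q ≡ ±1`, `det = q ≡ 1`. [cite: Serre1981, §8.1 eq. (238) (p. 188)]
[cite: DarmonDiamondTaylor1995, Prop. 2.8 (a)] -/
theorem frobSq_sub_one_sq_apply_eq_zero {q : ℕ} [Fact q.Prime] (hq3 : q ≠ 3)
    (hgood : W.HasGoodReductionAtPrime q) (hq1 : q % 3 = 1) (ha : ¬ 3 ∣ (W.frobeniusTrace q).natAbs)
    {v : HeightOneSpectrum (𝓞 ℚ)} (hv : (primesEquiv v : ℕ) = q)
    {𝔓 : Ideal (absIntegers (𝓞 ℚ) ℚ)} (h𝔓 : 𝔓 ∈ v.primesAbove)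
    {h : absoluteGaloisGroup ℚ} (hh : IsArithFrobAt (𝓞 ℚ) h 𝔓) (P : geomTorsion W (3 : ℕ)) :
    h • h • (h • h • P - P) - (h • h • P - P) = 0 := by
  haveI : Fact (Nat.Prime 3) := ⟨Nat.prime_three⟩
  letI : Module (ZMod 3) (geomTorsion W (3 : ℕ)) := AddSubgroup.torsionBy.zmodModule
  set f := (galoisRepTorsion W 3 h).toAdd.toAddMonoidHom.toZModLinearMap 3 with hfdef
  have hf : ∀ Q : geomTorsion W (3 : ℕ), f Q = h • Q := fun Q => rfl
  have htr : LinearMap.trace (ZMod 3) _ f = (W.frobeniusTrace q : ZMod 3) :=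
    W.trace_galoisRepTorsion_frobenius_eq 3 hq3 hgood hv h𝔓 hh
  have hdet : LinearMap.det f = (q : ZMod 3) := W.det_galoisRepTorsion_frobenius_eq 3 hq3 hgood hv h𝔓 hh
  have h2 : Module.finrank (ZMod 3) (geomTorsion W (3 : ℕ)) = 2 :=
    Literature.RepresentationTheory.FiniteGroups.Representation.finrank_eq_two_of_natCard_eq_sq
      (card_torsionPoints_eq_sq_holds W (AlgebraicClosure ℚ) (n := 3) (by norm_num))
  -- `q ≡ 1`, `a_q ≡ ±1 (mod 3)`
  have hq1' : (q : ZMod 3) = 1 := by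
    have : ((q % 3 : ℕ) : ZMod 3) = (q : ZMod 3) := by rw [ZMod.natCast_mod]
    rw [← this, hq1, Nat.cast_one]
  set a : ZMod 3 := (W.frobeniusTrace q : ZMod 3) with hadef
  have ha0 : a ≠ 0 := by
    intro h0
    rw [hadef, ZMod.intCast_zmod_eq_zero_iff_dvd] at h0
    exact ha (Int.natCast_dvd.mp h0)
  have haa : a * a = 1 := zmod3_mul_self_eq_one a ha0
  haveI : FiniteDimensional (ZMod 3) (geomTorsion W (3 : ℕ)) := Module.finite_of_finrank_eq_succ h2
  -- Cayley–Hamilton: `f (f Q) = a • f Q - Q`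
  have hff : ∀ Q : geomTorsion W (3 : ℕ), f (f Q) = a • f Q - Q := fun Q => by
    rw [apply_apply_eq_of_finrank_eq_two h2 f Q]
    erw [htr, hdet]
    rw [hq1', one_smul]
  -- the computation `g (g P) = 3 • (P - a • f P) = 0` for `g = f ∘ f - 1`
  have key : f (f (f (f P) - P)) - (f (f P) - P) = 0 := by
    have s2 : f (f (f (f P) - P)) = f (f (f (f P))) - f (f P) := by rw [map_sub, map_sub]
    have s3 : f (f (f P)) = a • f (f P) - f P := hff (f P)
    have s4 : f (f (f (f P))) = a • f (f (f P)) - f (f P) := hff (f (f P))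
    rw [s2, s4, s3, hff P]
    simp only [smul_sub, smul_smul, haa, one_smul]
    have hnorm : a • f P - P - a • f P - (a • f P - P) - (a • f P - P) - (a • f P - P - P) =
        (3 : ZMod 3) • (P - a • f P) := by
      module
    rw [hnorm, zmod3_three_eq_zero, zero_smul]
  simpa only [hf, map_sub] using key

end FrobUnipotent

/-! ## §B. Transport to `K` -/

section Residue

/-- The place of `ℚ` containing the rational prime `q` is `(q)` (maximality of `(q) ⊂ 𝓞 ℚ ≅ ℤ`). [folklore] -/
private theorem span_natCast_rat_eq' {q : ℕ} (hq : q.Prime) {v : HeightOneSpectrum (𝓞 ℚ)}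
    (hv : (q : 𝓞 ℚ) ∈ v.asIdeal) : Ideal.span {(q : 𝓞 ℚ)} = v.asIdeal := by
  have hprime : Prime (q : 𝓞 ℚ) := by
    rw [← MulEquiv.prime_iff (Rat.ringOfIntegersEquiv : 𝓞 ℚ ≃+* ℤ).toMulEquiv]
    change Prime (Rat.ringOfIntegersEquiv (q : 𝓞 ℚ))
    rw [map_natCast, ← Nat.prime_iff_prime_int]
    exact hq
  have hP : (Ideal.span {(q : 𝓞 ℚ)}).IsPrime := (Ideal.span_singleton_prime hprime.ne_zero).mpr hprime
  exact (hP.isMaximal (by rw [Ne, Ideal.span_singleton_eq_bot]; exact hprime.ne_zero)).eq_of_le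
    v.isPrime.ne_top ((Ideal.span_singleton_le_iff_mem _).mpr hv)

/-- Places of `ℚ` containing the same rational prime coincide. [folklore] -/
private theorem eq_of_natCast_mem_rat' {q : ℕ} (hq : q.Prime) {v v' : HeightOneSpectrum (𝓞 ℚ)}
    (hv : (q : 𝓞 ℚ) ∈ v.asIdeal) (hv' : (q : 𝓞 ℚ) ∈ v'.asIdeal) : v = v' :=
  HeightOneSpectrum.ext ((span_natCast_rat_eq' hq hv).symm.trans (span_natCast_rat_eq' hq hv'))

/-- The residue cardinality of the place of `ℚ` at `q` is `q`. [folklore] -/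
private theorem residueCard_rat_eq {q : ℕ} (hq : q.Prime) {v : HeightOneSpectrum (𝓞 ℚ)}
    (hv : (q : 𝓞 ℚ) ∈ v.asIdeal) : v.residueCard = q := by
  rw [HeightOneSpectrum.residueCard, ← span_natCast_rat_eq' hq hv, Ideal.absNorm_span_natCast,
    NumberField.RingOfIntegers.rank, Module.finrank_self, pow_one]

/-- The residue cardinality of the place of a quadratic field at an INERT rational prime `q` (`(q)` prime in `𝓞 K`)
is `q²`. [folklore] -/
private theorem residueCard_eq_sq_of_inert {K : Type} [Field K] [NumberField K] (hK2 : Module.finrank ℚ K = 2)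
    {q : ℕ} (hq : q.Prime) (hqP : (Ideal.span {(q : 𝓞 K)}).IsPrime) {w : HeightOneSpectrum (𝓞 K)}
    (hw : (q : 𝓞 K) ∈ w.asIdeal) : w.residueCard = q ^ 2 := by
  have hne : Ideal.span {(q : 𝓞 K)} ≠ ⊥ := by
    rw [Ne, Ideal.span_singleton_eq_bot]
    exact_mod_cast hq.ne_zero
  have heq : Ideal.span {(q : 𝓞 K)} = w.asIdeal :=
    (hqP.isMaximal hne).eq_of_le w.isPrime.ne_top ((Ideal.span_singleton_le_iff_mem _).mpr hw)
  rw [HeightOneSpectrum.residueCard, ← heq, Ideal.absNorm_span_natCast, NumberField.RingOfIntegers.rank, hK2]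

end Residue

section Transport

variable (W : WeierstrassCurve ℚ) (K : Type) [Field K] [NumberField K] [W.IsElliptic] [W.IsGloballyMinimal]

/-- **§B. Residue arithmetic at an inert prime.**  Let `K` be a quadratic field, `q` a rational prime
inert in `K` (`(q) ⊂ 𝓞 K` prime), `w ∋ q` its place, `𝔓 ∣ w` a prime of `\bar ℤ_K` with a
`K`-Frobenius `F` (`F x ≡ x^{#𝓞_K/w} = x^{q²}`), and `h` a `ℚ`-Frobenius at the trace prime
`𝔓' = 𝔓 ∩ \bar ℤ` above the place `v ∋ q` of `ℚ` (`h x ≡ x^q`).  Then `res(F) · (h h)⁻¹` lies in the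
inertia group `I_{𝔓'} ⊂ Γ_ℚ`: both `res F` and `h²` act as `x ↦ x^{q²}` on `\bar ℤ / 𝔓'`.
[cite: NeukirchANT1999, Ch. I §9 Prop. (9.4)–(9.6)] -/
theorem absGaloisRestrict_mul_inv_sq_mem_inertia (hK2 : Module.finrank ℚ K = 2) {q : ℕ} (hq : q.Prime)
    (hqP : (Ideal.span {(q : 𝓞 K)}).IsPrime) {w : HeightOneSpectrum (𝓞 K)} (hw : (q : 𝓞 K) ∈ w.asIdeal)
    {𝔓 : Ideal (absIntegers (𝓞 K) K)} (h𝔓 : 𝔓 ∈ w.primesAbove) {F : absoluteGaloisGroup K}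
    (hF : IsArithFrobAt (𝓞 K) F 𝔓) {v : HeightOneSpectrum (𝓞 ℚ)} (hv : (q : 𝓞 ℚ) ∈ v.asIdeal)
    (h𝔓' : 𝔓.comap (absIntegersMap ℚ K) ∈ v.primesAbove) {h : absoluteGaloisGroup ℚ}
    (hh : IsArithFrobAt (𝓞 ℚ) h (𝔓.comap (absIntegersMap ℚ K))) :
    absGaloisRestrict ℚ K F * (h * h)⁻¹ ∈ (𝔓.comap (absIntegersMap ℚ K)).inertia (absoluteGaloisGroup ℚ) := by
  haveI : (𝔓.comap (absIntegersMap ℚ K)).IsPrime := h𝔓'.1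
  set 𝔓' := 𝔓.comap (absIntegersMap ℚ K) with h𝔓'def
  have hNK : Nat.card (𝓞 K ⧸ 𝔓.under (𝓞 K)) = q ^ 2 := by
    rw [HeightOneSpectrum.card_quotient_under_eq_residueCard h𝔓, residueCard_eq_sq_of_inert hK2 hq hqP hw]
  have hNQ : Nat.card (𝓞 ℚ ⧸ 𝔓'.under (𝓞 ℚ)) = q := by
    rw [HeightOneSpectrum.card_quotient_under_eq_residueCard h𝔓', residueCard_rat_eq hq hv]
  -- `h h y ≡ y^{q²}` and `res F y ≡ y^{q²}` modulo `𝔓'`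
  have hh1 : ∀ y : absIntegers (𝓞 ℚ) ℚ, h • y - y ^ q ∈ 𝔓' := fun y ↦ by
    have := hh y
    rw [MulSemiringAction.toAlgHom_apply, hNQ] at this
    exact this
  have hh2 : ∀ y : absIntegers (𝓞 ℚ) ℚ, (h * h) • y - y ^ (q ^ 2) ∈ 𝔓' := fun y ↦ by
    have e1 : (h * h) • y - y ^ (q ^ 2) = (h • (h • y) - (h • y) ^ q) + ((h • y) ^ q - (y ^ q) ^ q) := by
      rw [mul_smul, pow_two, pow_mul]; abel
    rw [e1]
    refine 𝔓'.add_mem (hh1 (h • y)) ?_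
    obtain ⟨c, hc⟩ := sub_dvd_pow_sub_pow (h • y) (y ^ q) q
    rw [hc]
    exact 𝔓'.mul_mem_right c (hh1 y)
  have hF1 : ∀ y : absIntegers (𝓞 ℚ) ℚ, absGaloisRestrict ℚ K F • y - y ^ (q ^ 2) ∈ 𝔓' := fun y ↦ by
    rw [h𝔓'def, Ideal.mem_comap, map_sub, map_pow, absIntegersMap_smul]
    have := hF (absIntegersMap ℚ K y)
    rw [MulSemiringAction.toAlgHom_apply, hNK] at this
    exact this
  rw [Ideal.inertia, AddSubgroup.mem_inertia]
  intro x
  set y := (h * h)⁻¹ • x with hy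
  have hx : x = (h * h) • y := by rw [hy, smul_inv_smul]
  have e2 : (absGaloisRestrict ℚ K F * (h * h)⁻¹) • x - x =
      (absGaloisRestrict ℚ K F • y - y ^ (q ^ 2)) - ((h * h) • y - y ^ (q ^ 2)) := by
    rw [mul_smul, ← hy, hx, smul_inv_smul]
    · abel
  rw [e2]
  exact 𝔓'.sub_mem (hF1 y) (hh2 y)


omit [W.IsGloballyMinimal] in
/-- A prime not dividing the conductor is a prime of good reduction (private copy of the tree's
`hasGoodReductionAtPrime_of_not_dvd_conductorNorm`, file `HidaFamilyMembersProofs`, whose imports are not wanted here).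
[cite: Silverman1994, IV.10.2(a)] -/
private theorem hasGoodReductionAtPrime_of_not_dvd_conductorNorm' {ℓ : ℕ} [hℓ : Fact ℓ.Prime]
    (h : ¬ ℓ ∣ W.conductorNorm ℤ) : W.HasGoodReductionAtPrime ℓ := by
  set v : HeightOneSpectrum ℤ := (Rat.HeightOneSpectrum.primesEquiv (R := ℤ)).symm ⟨ℓ, hℓ.out⟩ with hv
  have hgen : Rat.HeightOneSpectrum.natGenerator v = ℓ :=
    congrArg Subtype.val ((Rat.HeightOneSpectrum.primesEquiv (R := ℤ)).apply_symm_apply ⟨ℓ, hℓ.out⟩)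
  have hfac : (W.conductorNorm ℤ).factorization ℓ = 0 := Nat.factorization_eq_zero_of_not_dvd h
  have hf : W.conductorExponent v = 0 := by
    rw [← W.factorization_conductorNorm_holds v, hgen, hfac]
  have hgood' : W.HasGoodReductionAt v := (WeierstrassCurve.conductorExponent_eq_zero_iff_holds v W).mp hf
  exact (W.hasGoodReductionAtPrime_iff_hasGoodReductionAt_holds ⟨ℓ, hℓ.out⟩).mpr hgood'

/-- **§B. The Frobenius package at the place of a good unipotent-admissible prime.**  Let `K` be
imaginary quadratic, `q` a unipotent-admissible prime of `E = W/ℚ` (`IsUAdmissiblePrime W K q`: `q ∤ 3N`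
prime, inert in `K`, `q ≡ 1 (mod 3)`, `3 ∤ a_q`) at which some Frobenius has `Frob_q² ≠ 1` on `E[3]`
(`FrobSqNeOneAt W 3 q`), `w ∋ q` the place of `K`, `𝔐` a prime of `\bar 𝓞_w` above `𝓂_w` and
`𝔓 = 𝔓_{ι₀,𝔐} ∣ w` the prime of `\bar ℤ_K` cut out by the chosen embedding `ι₀ : K̄ → K̄_w`.  Then there is
a `K`-Frobenius `F` at `𝔓` acting on `E[3](K̄)` as a non-trivial unipotent:
`F (F Q − Q) = F Q − Q` for all `Q`, and every `F`-fixed `Q` is of the form `F m − m`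
(`ker (F − 1) = im (F − 1)`, both of order `3`).  Proof: `F` exists (Neukirch I (9.4),
`exists_isArithFrobAt_of_mem_primesAbove_holds`); on `E[3](ℚ̄)`, `res F = j h'²` with `j ∈ I_{𝔓'}` acting
trivially (good reduction at `q ≠ 3`, Silverman VII.4.1) and `h'` a `ℚ`-Frobenius at `𝔓'` conjugate to the
given one, so `(F − 1)² = 0` by §A transported along `E[3](ℚ̄) ≃ E[3](K̄)` and `F ≠ 1`; then
`im (F − 1) ≤ ker (F − 1)` are subgroups of the group `E[3](K̄)` of order `9`, the first `≠ 0`, the second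
`≠ E[3]`, so both have order `3` and coincide. [cite: GrossLMS1991, §4 (4.1)–(4.3)]
[cite: SilvermanAEC2009, Prop. VII.4.1] -/
theorem exists_frobenius_unipotent (hK : IsImaginaryQuadratic K) (q : {q // IsUAdmissiblePrime W K q})
    (hq : FrobSqNeOneAt W 3 q.1) (w : HeightOneSpectrum (𝓞 K)) (hw : ((q : ℕ) : 𝓞 K) ∈ w.asIdeal)
    {𝔐 : Ideal w.localAbsIntegers} (h𝔐 : 𝔐 ∈ w.localPrimesAbove) :
    ∃ F : absoluteGaloisGroup K,
      IsArithFrobAt (𝓞 K) F (w.primeBelow (closureEmb (K := K) (w.adicCompletion K)) 𝔐) ∧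
      (∀ Q : geomTorsion (W.baseChange K) ((3 ^ 1 : ℕ) : ℤ), F • (F • Q - Q) - (F • Q - Q) = 0) ∧
      (∀ Q : geomTorsion (W.baseChange K) ((3 ^ 1 : ℕ) : ℤ), F • Q = Q →
        ∃ m : geomTorsion (W.baseChange K) ((3 ^ 1 : ℕ) : ℤ), F • m - m = Q) := by
  haveI : Algebra.IsQuadraticExtension ℚ K := ⟨hK.1⟩
  have hqp : (q : ℕ).Prime := q.2.1
  haveI : Fact (q : ℕ).Prime := ⟨hqp⟩
  have hq3 : (q : ℕ) ≠ 3 := q.2.2.2.2.1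
  have hqP : (Ideal.span {((q : ℕ) : 𝓞 K)}).IsPrime := q.2.2.2.2.2.1
  have hq1 : (q : ℕ) % 3 = 1 := q.2.2.2.2.2.2.1
  have ha : ¬ 3 ∣ (W.frobeniusTrace q).natAbs := q.2.2.2.2.2.2.2
  have hgood : W.HasGoodReductionAtPrime q := hasGoodReductionAtPrime_of_not_dvd_conductorNorm' W q.2.2.1
  -- ### the place `v₁` of `ℚ` below `w`
  set v₁ : HeightOneSpectrum (𝓞 ℚ) := w.under (𝓞 ℚ) with hv₁
  have hwv₁ : w.asIdeal.under (𝓞 ℚ) = v₁.asIdeal := rfl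
  have hqv₁ : ((q : ℕ) : 𝓞 ℚ) ∈ v₁.asIdeal := by
    rw [← hwv₁, Ideal.under_def, Ideal.mem_comap, map_natCast]
    exact hw
  have hv₁q : (primesEquiv v₁ : ℕ) = q := primesEquiv_eq_of_natCast_mem hqp hqv₁
  -- ### the primes `𝔓 ∣ w` (cut out by the chosen embedding) and `𝔓' = ι⁻¹ 𝔓 ∣ v₁`
  set ι₀ := closureEmb (K := K) (w.adicCompletion K) with hι₀
  set 𝔓 := w.primeBelow ι₀ 𝔐 with h𝔓def
  have h𝔓 : 𝔓 ∈ w.primesAbove := HeightOneSpectrum.primeBelow_mem_primesAbove h𝔐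
  set 𝔓' := 𝔓.comap (absIntegersMap ℚ K) with h𝔓'def
  have h𝔓' : 𝔓' ∈ v₁.primesAbove := comap_absIntegersMap_mem_primesAbove hwv₁ h𝔓
  haveI : 𝔓'.IsPrime := h𝔓'.1
  -- ### a `ℚ`-Frobenius `h'` at `𝔓'` with `h'² ≠ 1` on `E[3](ℚ̄)` (from `FrobSqNeOneAt`)
  obtain ⟨v₀, 𝔓₀, h₀, hqv₀, h𝔓₀, hFrob₀, P₀, hP₀⟩ := hq
  have hv : v₀ = v₁ := eq_of_natCast_mem_rat' hqp hqv₀ hqv₁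
  subst hv
  obtain ⟨τ, -, hFrob'⟩ :=
    HeightOneSpectrum.exists_isArithFrobAt_conj_of_mem_primesAbove_holds h𝔓₀ h𝔓' hFrob₀
  set h' := τ * h₀ * τ⁻¹ with hh'
  have hP' : h' • h' • (τ • P₀) ≠ τ • P₀ := by
    intro hc
    apply hP₀
    have hg : h' * h' * τ = τ * (h₀ * h₀) := by rw [hh']; group
    rw [smul_smul, smul_smul, hg, mul_smul, mul_smul] at hc
    exact smul_left_cancel τ hc
  -- ### a `K`-Frobenius `F` at `𝔓`; on `E[3](ℚ̄)`, `res F = h'²`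
  obtain ⟨F, hF⟩ := HeightOneSpectrum.exists_isArithFrobAt_of_mem_primesAbove_holds h𝔓
  have hj := absGaloisRestrict_mul_inv_sq_mem_inertia K hK.1 hqp hqP hw h𝔓 hF hqv₁ h𝔓' hFrob'
  -- `j = res F · (h'h')⁻¹ ∈ I_𝔓'` acts trivially on `E[3](ℚ̄)` (good reduction at `q ≠ 3`)
  have hgood₁ : W.HasGoodReductionAt v₁ := (hasGoodReductionAtPrime_primesEquiv_iff_holds W v₁ q hv₁q).mp hgood
  have h3v₁ : ((((3 ^ 1 : ℕ) : ℤ)) : 𝓞 ℚ) ∉ v₁.asIdeal := by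
    intro h3
    have hcop : Nat.Coprime (q : ℕ) 3 := (Nat.coprime_primes hqp Nat.prime_three).mpr hq3
    obtain ⟨a, b, hab⟩ := (Nat.isCoprime_iff_coprime.mpr hcop : IsCoprime ((q : ℕ) : ℤ) (3 : ℤ))
    apply v₁.isPrime.ne_top
    rw [Ideal.eq_top_iff_one]
    have h1 : (1 : 𝓞 ℚ) = (a : 𝓞 ℚ) * ((q : ℕ) : 𝓞 ℚ) + (b : 𝓞 ℚ) * ((((3 ^ 1 : ℕ) : ℤ)) : 𝓞 ℚ) := by
      rw [pow_one]
      exact_mod_cast congrArg (fun t : ℤ => (t : 𝓞 ℚ)) hab.symm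
    rw [h1]
    exact v₁.asIdeal.add_mem (v₁.asIdeal.mul_mem_left _ hqv₁) (v₁.asIdeal.mul_mem_left _ h3)
  have hjP : ∀ P : geomTorsion W ((3 ^ 1 : ℕ) : ℤ), (absGaloisRestrict ℚ K F * (h' * h')⁻¹) • P = P :=
    fun P ↦ W.smul_geomTorsion_eq_of_mem_inertia hgood₁ h3v₁ h𝔓' hj P
  have hres : ∀ P : geomTorsion W ((3 ^ 1 : ℕ) : ℤ), absGaloisRestrict ℚ K F • P = h' • h' • P := fun P ↦ by
    have h1 := hjP ((h' * h') • P)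
    rw [smul_smul, inv_mul_cancel_right] at h1
    rw [h1, mul_smul]
  -- ### transport to `E[3](K̄)`
  set θ := RatClosure.torsionEquiv (K := K) W ((3 ^ 1 : ℕ) : ℤ) with hθ
  have hFθ : ∀ P : geomTorsion W ((3 ^ 1 : ℕ) : ℤ), F • θ P = θ (h' • h' • P) := fun P ↦ by
    rw [← hres, RatClosure.torsionEquiv_smul]
  have hN2 : ∀ Q : geomTorsion (W.baseChange K) ((3 ^ 1 : ℕ) : ℤ), F • (F • Q - Q) - (F • Q - Q) = 0 := by
    intro Q
    obtain ⟨P, rfl⟩ := θ.surjective Q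
    rw [hFθ, ← map_sub, hFθ, ← map_sub]
    have hA := frobSq_sub_one_sq_apply_eq_zero W hq3 hgood hq1 ha hv₁q h𝔓' hFrob' P
    exact (congrArg θ hA).trans (map_zero θ)
  refine ⟨F, hF, hN2, ?_⟩
  -- ### `ker (F − 1) = im (F − 1)` by counting
  set N : geomTorsion (W.baseChange K) ((3 ^ 1 : ℕ) : ℤ) →+ geomTorsion (W.baseChange K) ((3 ^ 1 : ℕ) : ℤ) :=
    DistribSMul.toAddMonoidHom _ F - AddMonoidHom.id _ with hNdef
  have hN : ∀ Q, N Q = F • Q - Q := fun Q ↦ rfl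
  have hrange_le : N.range ≤ N.ker := by
    rintro _ ⟨Q, rfl⟩
    rw [AddMonoidHom.mem_ker, hN, hN, hN2]
  have hQ₀ : N (θ (τ • P₀)) ≠ 0 := by
    rw [hN, sub_ne_zero, hFθ]
    exact fun hc ↦ hP' (θ.injective hc)
  have h9 : Nat.card (geomTorsion (W.baseChange K) ((3 ^ 1 : ℕ) : ℤ)) = 9 := by
    rw [natCard_geomTorsion (W.baseChange K) ((3 ^ 1 : ℕ) : ℤ) (by norm_num)]
    norm_num
  haveI : Finite (geomTorsion (W.baseChange K) ((3 ^ 1 : ℕ) : ℤ)) :=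
    Nat.finite_of_card_ne_zero (by rw [h9]; norm_num)
  -- `#ker ≤ 3`
  have hker3 : Nat.card N.ker ≤ 3 := by
    have hdvd : Nat.card N.ker ∣ 3 ^ 2 := by
      rw [show (3 : ℕ) ^ 2 = 9 by norm_num, ← h9]; exact AddSubgroup.card_addSubgroup_dvd_card _
    have hne : Nat.card N.ker ≠ 9 := by
      intro h9'
      have htop : N.ker = ⊤ := AddSubgroup.eq_top_of_card_eq _ (by rw [h9', h9])
      apply hQ₀
      have : θ (τ • P₀) ∈ N.ker := by rw [htop]; exact AddSubgroup.mem_top _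
      exact this
    obtain ⟨k, hk, hk'⟩ := (Nat.dvd_prime_pow Nat.prime_three).mp hdvd
    rw [hk'] at hne ⊢
    interval_cases k
    · norm_num
    · norm_num
    · exact absurd rfl hne
  -- `#range ≥ 3`
  have hrange3 : 3 ≤ Nat.card N.range := by
    have hdvd : Nat.card N.range ∣ 3 ^ 2 := by
      rw [show (3 : ℕ) ^ 2 = 9 by norm_num, ← h9]; exact AddSubgroup.card_addSubgroup_dvd_card _
    have hne : Nat.card N.range ≠ 1 := by
      intro h1
      apply hQ₀
      have hbot : N.range = ⊥ := (AddSubgroup.eq_bot_iff_card _).mpr h1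
      have : N (θ (τ • P₀)) ∈ N.range := ⟨_, rfl⟩
      rw [hbot] at this
      exact this
    obtain ⟨k, hk, hk'⟩ := (Nat.dvd_prime_pow Nat.prime_three).mp hdvd
    rw [hk'] at hne ⊢
    interval_cases k
    · exact absurd rfl hne
    · norm_num
    · norm_num
  have heq : N.range = N.ker :=
    AddSubgroup.eq_of_le_of_card_ge hrange_le (hker3.trans hrange3)
  intro Q hQ
  have hQker : Q ∈ N.ker := by rw [AddMonoidHom.mem_ker, hN, hQ, sub_self]
  rw [← heq] at hQker
  obtain ⟨m, hm⟩ := hQker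
  exact ⟨m, by rw [← hN]; exact hm⟩

end Transport

end Summit.BirchSwinnertonDyer.Rank1Residual.X11b.Three.Koly.Method2.Iso

end
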